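import Literature.AlgebraicGeometry.Frobenioids.ArchimedeanFSMCounterexample
import Literature.AlgebraicGeometry.Frobenioids.ArchimedeanBaseRC
import HarnessLib

/-!
# Frobenioids II, Proposition 3.4 (viii): `N` over `D₀` is NOT of FSMFF-type
# (abc-iut cell, layer L1, node `FrdII:Prop3.4(viii)`, chain LC-L1-2 — the FSMFF conclusion at `π = 𝟭 D₀`)

Mochizuki, *The geometry of Frobenioids II: poly-Frobenioids*, Kyushu J. Math. **62** (2008)
401–460, §3, Proposition 3.4 (viii) p. 30: "Suppose that `D` is complexifiable, RC-connected, and of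
FSMFF-type. Then `F` is complexifiable, RC-connected, totally epimorphic, and of FSMFF-type"; proof
p. 33 ll. 17–44 (which invokes (iii) at l. 27). [cite: MochizukiFrdII2008, Prop 3.4 (viii) p.30]

PROVED here (proof-only file, nothing defined): for the non-rigidified angloid `N` over `D := D₀`,
`π := 𝟭 D₀`, the FSMFF conclusion FAILS: `N_id_not_isOfFSMFFType : ¬ IsOfFSMFFType (N (𝟭 D0))`;
and `D₀` over itself satisfies the typed hypotheses of (viii) (seat abc-iut-L1-t4's
`ArchimedeanBaseRC.lean`), so the `N`-conjunct of the typed item (viii) is FALSE: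
`towerN_id_not_propVIII`, `not_prop34_viii_id : ¬ Prop34_viii (𝟭 D0)`. Only clause (a) of
FSMFF-type (finite factorization into FSMI-morphisms) is used.
The argument: the FSM-morphism `φ` of `N.exists_fsm_witness_id` (complex → real, not an iso) would
have to factor as a finite composite of FSMI-morphisms ([FrdI] §0, `IsOfFSMFFType.factors`); but in
`N` over `D₀` there is NO FSMI-morphism from a complex object to a real object
(`N.not_isFSMI_complex_real_id`): if the domain's angular part is not all of `S¹`, the arrow factors
through the (naive) isotropic hull — neither factor invertible — so it is not irreducible; if it is
all of `S¹`, the conjugation automorphism `(conj, 1, c/conj(c))` of the domain has the same composite with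
it as the identity, so it is not a monomorphism. Since arrows of `D₀` out of `Spec ℝ` land in
`Spec ℝ`, every FSMI-chain starting at a complex object ends at a complex object
(`N.base_complex_of_isFSMIChain_id`). No side is taken on [IUTchIII] Cor. 3.12.
-/

namespace Literature.AlgebraicGeometry.Frobenioids

open CategoryTheory Set
open scoped Pointwise

noncomputable section

namespace ArchFrd

/-- Isotropy propagates along arrows of `C₀`: if the angular part of `X` is all of `S¹`, so is that of
the codomain of any `φ : X → Y` (condition (c) makes `c · A_X^{⊗d}` a subset of the twisted region of
`Y`, whose angular part is then all of `S¹`). [cite: MochizukiFrdII2008, Ex 3.3 (ii) p.28] -/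
theorem C0.dir_eq_univ_of_hom {X Y : C0} (φ : X ⟶ Y) (hX : X.region.dir = univ) :
    Y.region.dir = univ := by
  obtain ⟨A, hAc, -, hAd, -⟩ := exists_pulledRegion Y (C0.Base φ)
  have hm := φ.mapsTo
  change C0.scalar φ • X.region.carrier ^ (C0.degFr φ : ℕ) ⊆ C0.pullRegion Y (C0.Base φ) at hm
  rw [← (C0.degFr φ).natPred_add_one, ← hAc] at hm
  have h1 := ((X.region.smul_carrier_pow_subset_iff A (C0.scalar φ) (C0.degFr φ).natPred).mp hm).1
  rw [hX, Set.univ_pow (Nat.succ_ne_zero _), Set.smul_set_univ] at h1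
  have hA : A.dir = univ := Set.eq_univ_of_univ_subset h1
  rw [hAd] at hA
  -- the twist map `z ↦ unitPart (τ z)` is an involution of `S¹`
  have key : ∀ (τ : Bool) (w : ↥(normOneSubgroup ℂ)),
      unitPart ℂ (D0.galAct τ ((unitPart ℂ (D0.galAct τ (w : ℂˣ)) : ℂˣ))) = w := by
    intro τ w
    cases τ
    · rw [D0.galAct_false, unitPart_normOne_coe, D0.galAct_false, unitPart_normOne_coe]
    · rw [unitPart_galAct_true, unitPart_galAct_true, unitPart_normOne_coe, unitPart_normOne_coe, inv_inv]
  have key' : ∀ w : ↥(normOneSubgroup ℂ),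
      unitPart ℂ ((C0.Base φ).act ((unitPart ℂ ((C0.Base φ).act (w : ℂˣ)) : ℂˣ))) = w :=
    fun w => key _ w
  ext z
  refine ⟨fun _ => trivial, fun _ => ?_⟩
  have hz : (fun w : ↥(normOneSubgroup ℂ) => unitPart ℂ ((C0.Base φ).act (w : ℂˣ))) z ∈
      (fun w : ↥(normOneSubgroup ℂ) => unitPart ℂ ((C0.Base φ).act (w : ℂˣ))) '' Y.region.dir := by
    rw [hA]
    trivial
  obtain ⟨w, hw, hgw⟩ := hz
  have hwz : w = z := by
    have := congrArg (fun v : ↥(normOneSubgroup ℂ) => unitPart ℂ ((C0.Base φ).act (v : ℂˣ))) hgw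
    simp only [key'] at this
    exact this
  exact hwz ▸ hw

/-- In `N` over `D₀` there is no FSMI-morphism from a complex object to a real object.
[cite: MochizukiFrdII2008, Prop 3.4 (viii) p.33] -/
theorem N.not_isFSMI_complex_real_id {RP : AngularRegion ℂ}
    (hRP : D0.complex = D0.real → RP.IsIsotropic) {PD : D0}
    (ιP : (PreFrobenioid.baseFunctor C0.toElem).obj (C0.mk D0.complex RP hRP) ≅ (𝟭 D0).obj PD)
    {RQ : AngularRegion ℂ} (hRQ : D0.real = D0.real → RQ.IsIsotropic) {QD : D0}
    (ιQ : (PreFrobenioid.baseFunctor C0.toElem).obj (C0.mk D0.real RQ hRQ) ≅ (𝟭 D0).obj QD)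
    (φ : (⟨⟨⟨C0.mk D0.complex RP hRP, PD, ιP⟩⟩⟩ : N (𝟭 D0)) ⟶ ⟨⟨⟨C0.mk D0.real RQ hRQ, QD, ιQ⟩⟩⟩) :
    ¬ IsFSMI φ := by
  intro hφ
  set φ0 := φ.hom.hom.fst with hφ0def
  have hd : C0.degFr φ0 = 1 := φ.property
  have hI : PreFrobenioid.IsIsometry C0.toElem φ0 := φ.hom.property
  have hφt : ‖((C0.scalar φ0 : ℂˣ) : ℂ)‖ * (RP.tip : ℝ) = (RQ.tip : ℝ) := by
    have := (A0.isIsometry_iff_norm_mul_tip_pow φ0).mp hI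
    rw [hd, PNat.one_coe, pow_one] at this
    exact this
  by_cases hisoP : RP.IsIsotropic
  · -- the conjugation automorphism of P has the same composite with φ as the identity
    set c : ℂˣ := C0.scalar φ0 with hc
    have hw : absHom ℂ (c * (D0.galAct true c)⁻¹) = 1 := by
      rw [map_mul, map_inv, C0.absHom_galAct, mul_inv_cancel]
    have hmb : (c * (D0.galAct true c)⁻¹) • (C0.mk D0.complex RP hRP).region.carrier ^ ((1 : ℕ+) : ℕ) ⊆
        C0.pullRegion (C0.mk D0.complex RP hRP) D0.conj := by
      rw [PNat.one_coe, pow_one]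
      rintro _ ⟨u, hu, rfl⟩
      show (c * (D0.galAct true c)⁻¹) • u ∈ D0.conj.act '' RP.carrier
      unfold D0.Hom.act
      rw [D0.twists_conj, C0.image_galAct_of_isIsotropic hisoP, C0.mem_carrier_of_isIsotropic hisoP,
        smul_eq_mul, map_mul, hw, one_mul]
      exact hu.2
    have hmem : c * (D0.galAct true c)⁻¹ ∈ D0.scalars (C0.mk D0.complex RP hRP).base := by
      show _ ∈ D0.scalars D0.complex
      rw [D0.scalars_complex]
      exact Subgroup.mem_top _
    let b0 : C0.mk D0.complex RP hRP ⟶ C0.mk D0.complex RP hRP := ⟨D0.conj, 1, _, hmem, hmb⟩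
    have hb0I : PreFrobenioid.IsIsometry C0.toElem b0 := by
      rw [A0.isIsometry_iff_norm_mul_tip_pow]
      show ‖((c * (D0.galAct true c)⁻¹ : ℂˣ) : ℂ)‖ * (RP.tip : ℝ) ^ ((1 : ℕ+) : ℕ) = (RP.tip : ℝ)
      rw [← coe_absHom, hw, Positive.val_one, one_mul, PNat.one_coe, pow_one]
    have sq : (PreFrobenioid.baseFunctor C0.toElem).map b0 ≫ ιP.hom =
        ιP.hom ≫ (𝟭 D0).map (ιP.inv ≫ D0.conj ≫ ιP.hom) := by
      show D0.conj ≫ ιP.hom = ιP.hom ≫ (ιP.inv ≫ D0.conj ≫ ιP.hom)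
      exact (ιP.hom_inv_id_assoc _).symm
    let PC : C (𝟭 D0) := ⟨C0.mk D0.complex RP hRP, PD, ιP⟩
    let PN : N (𝟭 D0) := ⟨⟨PC⟩⟩
    let bC : PC ⟶ PC := ⟨b0, ιP.inv ≫ D0.conj ≫ ιP.hom, sq⟩
    have hbiso : PreFrobenioid.isometricMorphisms (C.toElem (𝟭 D0)) bC := hb0I
    have hblin : PreFrobenioid.linearMorphisms (A.toElem (𝟭 D0)) (⟨bC, hbiso⟩ : PN.obj ⟶ PN.obj) :=
      (rfl : C0.degFr b0 = 1)
    let b : PN ⟶ PN := ⟨⟨bC, hbiso⟩, hblin⟩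
    have heq : b ≫ φ = 𝟙 _ ≫ φ := by
      rw [Category.id_comp]
      apply WideSubcategory.hom_ext _
      apply WideSubcategory.hom_ext _
      refine CFP.hom_ext ?_ ?_
      · show b0 ≫ φ0 = φ0
        refine C0.hom_ext (D0.hom_to_real_eq rfl _ _) ?_ ?_
        · rw [C0.degFr_comp']
          exact one_mul _
        · rw [C0.scalar_comp', hd, PNat.one_coe, pow_one]
          show D0.galAct (D0.Hom.twists D0.conj) c * (c * (D0.galAct true c)⁻¹) = c
          rw [D0.twists_conj, mul_left_comm, mul_inv_cancel, mul_one]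
      · show (ιP.inv ≫ D0.conj ≫ ιP.hom) ≫ φ.hom.hom.snd = φ.hom.hom.snd
        exact (cancel_mono ιQ.inv).mp (D0.hom_to_real_eq rfl _ _)
    haveI := hφ.1.2
    have hb1 := (cancel_mono φ).mp heq
    have hbase := congrArg (fun f => C0.Base f.hom.hom.fst) hb1
    exact D0.conj_ne_id hbase
  · -- factor through the isotropic hull: neither factor is an isomorphism
    let RP' : AngularRegion ℂ := AngularRegion.isotropicOfTip RP.tip
    have hRP' : D0.complex = D0.real → RP'.IsIsotropic := fun h => nomatch h
    have hmβ : (1 : ℂˣ) • (C0.mk D0.complex RP hRP).region.carrier ^ ((1 : ℕ+) : ℕ) ⊆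
        C0.pullRegion (C0.mk D0.complex RP' hRP') (𝟙 D0.complex) := by
      rw [one_smul, PNat.one_coe, pow_one, C0.pullRegion_id]
      intro u hu
      rw [C0.mem_carrier_of_isIsotropic (AngularRegion.isIsotropic_isotropicOfTip _)]
      exact hu.2
    let β0 : C0.mk D0.complex RP hRP ⟶ C0.mk D0.complex RP' hRP' := ⟨𝟙 D0.complex, 1, 1, one_mem _, hmβ⟩
    have hβI : PreFrobenioid.IsIsometry C0.toElem β0 := by
      rw [A0.isIsometry_iff_norm_mul_tip_pow]
      show ‖((1 : ℂˣ) : ℂ)‖ * (RP.tip : ℝ) ^ ((1 : ℕ+) : ℕ) = (RP.tip : ℝ)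
      rw [Units.val_one, norm_one, one_mul, PNat.one_coe, pow_one]
    have hmα : C0.scalar φ0 • (C0.mk D0.complex RP' hRP').region.carrier ^ ((1 : ℕ+) : ℕ) ⊆
        C0.pullRegion (C0.mk D0.real RQ hRQ) (C0.Base φ0) := by
      rw [PNat.one_coe, pow_one]
      rintro _ ⟨u, hu, rfl⟩
      show C0.scalar φ0 • u ∈ (C0.Base φ0).act '' RQ.carrier
      unfold D0.Hom.act
      rw [D0.twists_of_real, D0.image_galAct_false, C0.mem_carrier_of_isIsotropic (hRQ rfl),
        absHom_le_iff, smul_eq_mul, Units.val_mul, norm_mul, ← hφt]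
      have hu' : ‖(u : ℂ)‖ ≤ (RP.tip : ℝ) :=
        (absHom_le_iff u RP.tip).mp ((C0.mem_carrier_of_isIsotropic
          (AngularRegion.isIsotropic_isotropicOfTip _) u).mp hu)
      exact mul_le_mul_of_nonneg_left hu' (norm_nonneg _)
    let α0 : C0.mk D0.complex RP' hRP' ⟶ C0.mk D0.real RQ hRQ :=
      ⟨(C0.Base φ0 :), 1, C0.scalar φ0, φ0.scalar_mem, hmα⟩
    have hαI : PreFrobenioid.IsIsometry C0.toElem α0 := by
      rw [A0.isIsometry_iff_norm_mul_tip_pow]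
      show ‖((C0.scalar φ0 : ℂˣ) : ℂ)‖ * (RP.tip : ℝ) ^ ((1 : ℕ+) : ℕ) = (RQ.tip : ℝ)
      rw [PNat.one_coe, pow_one, hφt]
    have hβα : β0 ≫ α0 = φ0 := by
      refine C0.hom_ext (D0.hom_to_real_eq rfl _ _) ?_ ?_
      · rw [C0.degFr_comp', hd]
        rfl
      · rw [C0.scalar_comp']
        show D0.galAct (D0.Hom.twists (𝟙 D0.complex)) (C0.scalar φ0) * 1 ^ ((1 : ℕ+) : ℕ) = C0.scalar φ0
        rw [D0.twists_id, D0.galAct_false, one_pow, mul_one]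
    -- in N
    let PC : C (𝟭 D0) := ⟨C0.mk D0.complex RP hRP, PD, ιP⟩
    let PN : N (𝟭 D0) := ⟨⟨PC⟩⟩
    let P'C : C (𝟭 D0) := ⟨C0.mk D0.complex RP' hRP', PD, ιP⟩
    let P' : N (𝟭 D0) := ⟨⟨P'C⟩⟩
    let QC : C (𝟭 D0) := ⟨C0.mk D0.real RQ hRQ, QD, ιQ⟩
    let QN : N (𝟭 D0) := ⟨⟨QC⟩⟩
    have sqβ : (PreFrobenioid.baseFunctor C0.toElem).map β0 ≫ ιP.hom = ιP.hom ≫ (𝟭 D0).map (𝟙 PD) := by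
      show 𝟙 D0.complex ≫ ιP.hom = ιP.hom ≫ 𝟙 PD
      exact (Category.id_comp _).trans (Category.comp_id _).symm
    let βC : PC ⟶ P'C := ⟨β0, 𝟙 PD, sqβ⟩
    have hβiso : PreFrobenioid.isometricMorphisms (C.toElem (𝟭 D0)) βC := hβI
    have hβlin : PreFrobenioid.linearMorphisms (A.toElem (𝟭 D0)) (⟨βC, hβiso⟩ : PN.obj ⟶ P'.obj) :=
      (rfl : C0.degFr β0 = 1)
    let β : PN ⟶ P' := ⟨⟨βC, hβiso⟩, hβlin⟩
    have wα : (PreFrobenioid.baseFunctor C0.toElem).map α0 ≫ ιQ.hom = ιP.hom ≫ (𝟭 D0).map φ.hom.hom.snd :=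
      φ.hom.hom.w
    let αC : P'C ⟶ QC := ⟨α0, φ.hom.hom.snd, wα⟩
    have hαiso : PreFrobenioid.isometricMorphisms (C.toElem (𝟭 D0)) αC := hαI
    have hαlin : PreFrobenioid.linearMorphisms (A.toElem (𝟭 D0)) (⟨αC, hαiso⟩ : P'.obj ⟶ QN.obj) :=
      (rfl : C0.degFr α0 = 1)
    let α : P' ⟶ QN := ⟨⟨αC, hαiso⟩, hαlin⟩
    have hfac : β ≫ α = φ := by
      apply WideSubcategory.hom_ext _
      apply WideSubcategory.hom_ext _
      exact CFP.hom_ext hβα (Category.id_comp _)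
    rcases hφ.2.2 β α hfac with hα | hβ
    · haveI := hα
      exact (D0.isEmpty_hom_real_complex.false (C0.Base (inv α).hom.hom.fst)).elim
    · haveI := hβ
      -- the inverse of β is an arrow from the isotropic object P' to P, so P is isotropic
      exact hisoP (C0.dir_eq_univ_of_hom (inv β).hom.hom.fst rfl)

/-- A single FSMI step of `N` over `D₀` out of a complex object ends at a complex object.
[cite: MochizukiFrdII2008, Prop 3.4 (viii) p.33] -/
theorem N.base_complex_of_isFSMI_id {P Q : N (𝟭 D0)} (φ : P ⟶ Q) (hφ : IsFSMI φ)
    (hP : P.obj.obj.fst.base = D0.complex) : Q.obj.obj.fst.base = D0.complex := by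
  obtain ⟨⟨⟨⟨KP, RP, hRP⟩, PD, ιP⟩⟩⟩ := P
  obtain ⟨⟨⟨⟨KQ, RQ, hRQ⟩, QD, ιQ⟩⟩⟩ := Q
  change KP = D0.complex at hP
  subst hP
  cases KQ with
  | complex => rfl
  | real => exact (N.not_isFSMI_complex_real_id hRP ιP hRQ ιQ φ hφ).elim

/-- Every finite chain of FSMI-morphisms of `N` over `D₀` starting at a complex object ends at a
complex object. [cite: MochizukiFrdII2008, Prop 3.4 (viii) p.33] -/
theorem N.base_complex_of_isFSMIChain_id {P Q : N (𝟭 D0)} {φ : P ⟶ Q} {n : ℕ}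
    (h : IsFSMIChain φ n) : P.obj.obj.fst.base = D0.complex → Q.obj.obj.fst.base = D0.complex := by
  induction h with
  | single φ hφ => exact fun hP => N.base_complex_of_isFSMI_id φ hφ hP
  | cons ψ χ n hψ _ ih => exact fun hP => ih (N.base_complex_of_isFSMI_id ψ hψ hP)

/-- **`N` over `D₀` is NOT of FSMFF-type**: the FSM-morphism of `N.exists_fsm_witness_id` (complex →
real, not invertible) admits no factorization into FSMI-morphisms.
[cite: MochizukiFrdII2008, Prop 3.4 (viii) p.30] -/
theorem N_id_not_isOfFSMFFType : ¬ IsOfFSMFFType (N (𝟭 D0)) := by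
  intro h
  obtain ⟨X, Y, φ, hX, hY, hFSM, -⟩ := N.exists_fsm_witness_id
  have hnotIso : ¬ IsIso φ := by
    intro hi
    exact D0.isEmpty_hom_real_complex.false
      (eqToHom hY.symm ≫ C0.Base (inv φ).hom.hom.fst ≫ eqToHom hX)
  obtain ⟨n, hchain⟩ := h.factors φ hFSM hnotIso
  have := N.base_complex_of_isFSMIChain_id hchain hX
  rw [hY] at this
  exact nomatch this

/-- **Prop. 3.4 (viii) fails for `F = N` over `D = D₀`**: `D₀` is complexifiable, RC-connected and of
FSMFF-type (seat abc-iut-L1-t4's `ArchimedeanBaseRC`: `D0.rc_isComplexifiable_id_comp`,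
`D0.rc_isRCConnected_id_comp`, `D0.isOfFSMFFType`), but the conclusion "`F` is of FSMFF-type" is
false. Only clause (a) (`IsOfFSMFFType.factors`) of FSMFF-type is used, so the refutation is
insensitive to the author's 2024 replacement of clause (b) ('Comments on FrdI', item (28)).
[cite: MochizukiFrdII2008, Prop 3.4 (viii) p.30] -/
theorem towerN_id_not_propVIII : ¬ (towerN (𝟭 D0)).PropVIII :=
  fun h => N_id_not_isOfFSMFFType
    (h D0.rc_isComplexifiable_id_comp D0.rc_isRCConnected_id_comp D0.isOfFSMFFType).2.2.2

/-- **Proposition 3.4 (viii) as typed (`Prop34_viii π`) is FALSE at `π = 𝟭 D₀`.**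
[cite: MochizukiFrdII2008, Prop 3.4 (viii) p.30] -/
theorem not_prop34_viii_id : ¬ Prop34_viii (𝟭 D0) := fun h => towerN_id_not_propVIII h.2.1

end ArchFrd

end

end Literature.AlgebraicGeometry.Frobenioids
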